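import Summits.BirchSwinnertonDyer.BirchSwinnertonDyer.Theorems.SylvesterTwoHeegnerIndexLevelFixingSeven
import Summits.BirchSwinnertonDyer.BirchSwinnertonDyer.Theorems.SylvesterTwoHeegnerIndexFirstLayerSplit
import Summits.BirchSwinnertonDyer.BirchSwinnertonDyer.Theorems.SylvesterTwoHeegnerIndexCoupledUpperBoundReductionSeven
import Summits.BirchSwinnertonDyer.BirchSwinnertonDyer.Theorems.SylvesterTwoHeegnerIndexCoupledDescentFirstLayerOfLayerL1
import Summits.BirchSwinnertonDyer.BirchSwinnertonDyer.Theorems.SylvesterTwoHeegnerIndexCMFlipLayerL1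
import Summits.BirchSwinnertonDyer.BirchSwinnertonDyer.Theorems.SylvesterTwoHeegnerIndexCMHalfInvolutionFixingBottomOfLevel
import Summits.BirchSwinnertonDyer.BirchSwinnertonDyer.Theorems.SylvesterTwoHeegnerIndexCoupledTelescopeTailFourOfResidue
import Summits.BirchSwinnertonDyer.BirchSwinnertonDyer.Theorems.SylvesterTwoHeegnerIndexCoupledTelescopeTailSevenOfResidueHalved
import Summits.BirchSwinnertonDyer.BirchSwinnertonDyer.Theorems.SylvesterTwoHeegnerIndexCoupledTelescopeConeDischarge
import Summits.BirchSwinnertonDyer.BirchSwinnertonDyer.Theorems.SylvesterTwoHeegnerIndexCoupledTelescopeResidueFour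
import Summits.BirchSwinnertonDyer.BirchSwinnertonDyer.Theorems.SylvesterTwoHeegnerIndexCoupledTelescopeResidueSevenHalved
import Summits.BirchSwinnertonDyer.BirchSwinnertonDyer.Theorems.SylvesterTwoHeegnerIndexUpperOfPartsPlusHSY
import Summits.BirchSwinnertonDyer.BirchSwinnertonDyer.Theorems.SylvesterTwoHeegnerIndexTwoAdicPairHSYOfFactsPlusOfThmC
import Literature.NumberTheory.EllipticCurves.CasselsTateCanonicalAdjoint
import HarnessLib

/-!
# Route `SylvesterTwoHeegnerIndex` (rung K7t): THE UPPER CONE BY NAME FROM THE PRINT INPUTS ALONE — the kernel census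
# after (W2-b) (crux `UpperOffV0HSYPlus` stmt-BirchSwinnertonDyer-19804, THEOREM C stmt-…-19802, UPPER
# `HeegnerIndexUpperAtTwoHSYOfFactsPlus` stmt-…-19725, the hand item `HeegnerIndexUpperAtTwoHSY` stmt-…-19229)

Cell `bsd-cm`, seat `bsd-cm-k7t-c2` g34 (hand «find: 19229 `HeegnerIndexUpperAtTwoHSY`»).  THEOREMS ONLY: composition of
landed theorems; no definition, no named fact, no instance, no notation, no `sorry`.  `--supports stmt-BirchSwinnertonDyer-19804
--as helper`.

WHAT THIS FILE IS.  The skeleton of record of crux 19804 (VARIANT R′, `Cruxes/UpperOffV0HSYPlus/Lines/coupled_variantQ.lean`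
bc3d3f9d1ef1570c) composes the crux `UpperOffV0HSYPlus` from three registered stubs: the two PURE-CITE print stubs
`stub_printInputsTwo` (a degree-6 modular parametrisation `Dt` of `E₉ = ⟨0,0,1,0,−1⟩` at level `243`; Hu–Shu–Yin's named
height display #19 `shaAnPair_mul_height_eq_two_zpow_mul_height_named`; Nekovář's congruence (ES2) #20
`Nekovar2007.cmPoint_frobeniusCongruence`) and `stub_printInputVII` (the named pairing fact `casselsTate_canonical_adjoint`
for every quadratic `K`), and the ONE research stub `stub_levelFixingSeven` ((W2-b): the decomposition involution at `w ∣ 3`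
fixes Hu–Shu–Yin's CM point of conductor `9pn`).  Seat g33 proved the research stub for every `⟨w₂₄₃, A⟩`-invariant `Dt`
(`SylvesterTwoLevelFixingSeven.levelFixingSeven_of_isS3Invariant`, p754511) and hence from the one admitted print input (G3)
= k-ty1's named Literature fact `phi_s3Invariant_of_deg_eq_six` (Hu–Shu–Yin Prop. 2.1 (1): `E₉ = X₀(3⁵)/S₃`).  This file RUNS
the skeleton's composition on the Theorems side with the research stub replaced by that theorem, so that every statement of
the UPPER cone is a kernel-checked CONDITIONAL theorem whose hypotheses are print inputs ONLY:

* §1 `thmC_of_isS3Invariant` / `thmC_of_printStubs` — THEOREM C (`SylvesterTwoNonneg.HSYPointTwoDivisibleSevenModNine`, granted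
  `PublishedFactsTwoPlus`) and ★ `hsyPointTwoDivisibleSevenModNine_of_printStubs` — the ROUTE DECL of item 19802 BY NAME;
* §2 `coupledUpperBoundFour_of_prints`, `coupledUpperBoundSeven_of_isS3Invariant` (THEOREMS K3 / K3\* typed), ★★
  `upperOffV0HSYPlus_of_isS3Invariant (Dt) (hdeg) (hD) (hES2) (hS3) (hVII)` and ★★ `upperOffV0HSYPlus_of_printStubs (hPI) (hVII)`
  — the ROUTE DECL of crux 19804 BY NAME from EXACTLY the types of the two PURE-CITE stubs of the planner's pre-announced
  VARIANT S (D834 (3): `stub_printInputsTwo` with the fourth conjunct (G3), `stub_printInputVII`), nothing else;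
* §3 ★★ `heegnerIndexUpperAtTwoHSYOfFactsPlus_of_printStubs` — the ROUTE DECL of item 19725 BY NAME (glue 19805 p431798 ∘ the
  closed child 19803 ∘ §1 ∘ §2); ★★★ `heegnerIndexUpperAtTwoHSY_of_publishedFactsTwoPlus_of_printStubs` — THE HAND ITEM 19229
  BY NAME from `PublishedFactsTwoPlus` and the two print stubs; ★★★ `cmAtTwo_of_lower_of_publishedFactsTwoPlus_of_printStubs` —
  the rung leaf `X12.CMAtTwo` from the LOWER half (`HeegnerIndexLowerAtTwoHSY`, OPEN), `PublishedFactsTwoPlus` and the two print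
  stubs, through the closed Assembly 19232.

READING OF RECORD (kernel-checked here): UPPER cone of K7t ⟸ PRINT {`PublishedFactsTwoPlus`; deg-6 `Dt`, #19 named, #20 (ES2),
(G3), VII} — ZERO research hypotheses.

HONEST LABEL: CONDITIONAL closures — every print input above is DISPLAYED as a hypothesis (named Literature `Prop`s / the
existence of a degree-6 `Dt`), not proved; (G3) is an ADMITTED print binder (planner D816/D819); the LOWER half is an OPEN crux
displayed as a hypothesis in the last theorem.  No ledger item is closed by this file; items 19229/19725/19802/19804 stay as
the ledger has them; X12.CMAtTwo is NOT proved; BSD is proved for no curve, by none of this.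

## References
* Y. Hu, J. Shu, H. Yin, *An explicit Gross–Zagier formula related to the Sylvester conjecture*, Trans. AMS 372 (2019)
  = arXiv:1708.05266: Thm. 1.4, Prop. 2.1 (1), §2.2, Cor. 4.4, display (bsd) p. 12, §4.1. [HuShuYin2019]
* J. Nekovář, *The Euler system method for CM points on Shimura curves* (2007), Prop. 4.9. [Nekovar2007]
* B. H. Gross, *Kolyvagin's work on modular elliptic curves*, LMS LNS 153 (1991), §3–§6. [GrossLMS1991]
* W. G. McCallum, *Kolyvagin's work on Shafarevich–Tate groups*, LMS LNS 153 (1991), §4–§5, Thm. 5.4. [McCallumLMS1991]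
* J. S. Milne, *Arithmetic Duality Theorems*, 2nd ed. (2006), Ch. I §6. [MilneADT2006]
* B. H. Gross, D. B. Zagier, *Heegner points and derivatives of L-series*, Invent. Math. 84 (1986), V §2. [GrossZagier1986]
-/

set_option linter.dupNamespace false -- Summits modules are `Summit.<Summit>.<Problem>…` by design
set_option autoImplicit false

noncomputable section

open scoped Classical AddSubgroup

open WeierstrassCurve Field NumberField IsDedekindDomain
open Literature.NumberTheory.EllipticCurves Literature.NumberTheory.EllipticCurves.ModularForms
  Literature.NumberTheory.EllipticCurves.HuShuYin2019
  Literature.NumberTheory.GaloisRepresentations Literature.NumberTheory.GaloisCohomology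
  Literature.GroupTheory.FiniteAbelian Literature.NumberTheory.EllipticCurves.KolyvaginDescent
open Literature.NumberTheory.GaloisRepresentations.DiscreteGaloisModule (mu)
open Summit.BirchSwinnertonDyer.BirchSwinnertonDyer.Theses.SylvesterTwoHeegnerIndex
  hiding HSYPointTwoDivisibleSevenModNine
open Summit.BirchSwinnertonDyer.BirchSwinnertonDyer.Theorems
  Summit.BirchSwinnertonDyer.BirchSwinnertonDyer.Theorems.SylvesterTwoCoupledUpperBound
  Summit.BirchSwinnertonDyer.BirchSwinnertonDyer.Theorems.SylvesterTwoFirstLayerSplit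
  Summit.BirchSwinnertonDyer.BirchSwinnertonDyer.Theorems.SylvesterTwoCoupledDescentCebotarev
  Summit.BirchSwinnertonDyer.BirchSwinnertonDyer.Theorems.SylvesterTwoCoupledTelescope
  Summit.BirchSwinnertonDyer.BirchSwinnertonDyer.Theorems.SylvesterTwoLevelFixingSeven
  Summit.BirchSwinnertonDyer.Rank1Residual.X11b Summit.BirchSwinnertonDyer.Rank1Residual.X11b.RingClassTower

namespace Summit.BirchSwinnertonDyer.BirchSwinnertonDyer.Theorems.SylvesterTwoUpperCone

/-! ## §1 THEOREM C (item 19802) from the prints -/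

/-- **THEOREM C from a `⟨w₂₄₃, A⟩`-invariant degree-6 `Dt` and the named height display #19**, granted
`PublishedFactsTwoPlus`: `thmC_of_named_of_levelInvolutionFixing` (p690231 ∘ bottom-of-level) fed with g33's
`levelFixingSeven_of_isS3Invariant`.  CONDITIONAL; closes nothing by itself; BSD is proved for no curve.
[cite: HuShuYin2019, Prop. 2.1 (1), §2.2, display (bsd) p. 12, §4.1] [cite: GrossLMS1991, §3] -/
theorem thmC_of_isS3Invariant
    (Dt : ModularParametrizationData (⟨0, 0, 1, 0, -1⟩ : WeierstrassCurve ℚ) 243) (hdeg : Dt.deg = 6)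
    (hD : shaAnPair_mul_height_eq_two_zpow_mul_height_named) (hS3 : IsS3Invariant Dt) :
    PublishedFactsTwoPlus → SylvesterTwoNonneg.HSYPointTwoDivisibleSevenModNine :=
  SylvesterTwoCMHalf.thmC_of_named_of_levelInvolutionFixing Dt hdeg hD (levelFixingSeven_of_isS3Invariant Dt hS3)

/-- **THEOREM C from the type of VARIANT S's `stub_printInputsTwo`** (deg-6 `Dt` ∧ #19 ∧ #20 ∧ (G3)), granted
`PublishedFactsTwoPlus`.  CONDITIONAL; BSD is proved for no curve.
[cite: HuShuYin2019, Prop. 2.1 (1), §2.2, display (bsd) p. 12, §4.1] [cite: GrossLMS1991, §3] -/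
theorem thmC_of_printStubs
    (hPI : (∃ Dt : ModularParametrizationData (⟨0, 0, 1, 0, -1⟩ : WeierstrassCurve ℚ) 243, Dt.deg = 6) ∧
      shaAnPair_mul_height_eq_two_zpow_mul_height_named ∧ Nekovar2007.cmPoint_frobeniusCongruence ∧
      phi_s3Invariant_of_deg_eq_six) :
    PublishedFactsTwoPlus → SylvesterTwoNonneg.HSYPointTwoDivisibleSevenModNine := by
  obtain ⟨⟨Dt, hdeg⟩, hD, -, hG3⟩ := hPI
  exact thmC_of_isS3Invariant Dt hdeg hD (hG3 Dt hdeg)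

/-- ★ **The ROUTE DECL of item 19802 `HSYPointTwoDivisibleSevenModNine` BY NAME from the print stub type**, granted
`PublishedFactsTwoPlus` (the route decl is the cell def `SylvesterTwoNonneg.HSYPointTwoDivisibleSevenModNine` inlined
verbatim, `Iff.rfl`).  CONDITIONAL; item 19802 is not closed by this; BSD is proved for no curve.
[cite: HuShuYin2019, Prop. 2.1 (1), §2.2, display (bsd) p. 12, §4.1] [cite: GrossLMS1991, §3] -/
theorem hsyPointTwoDivisibleSevenModNine_of_printStubs
    (hPI : (∃ Dt : ModularParametrizationData (⟨0, 0, 1, 0, -1⟩ : WeierstrassCurve ℚ) 243, Dt.deg = 6) ∧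
      shaAnPair_mul_height_eq_two_zpow_mul_height_named ∧ Nekovar2007.cmPoint_frobeniusCongruence ∧
      phi_s3Invariant_of_deg_eq_six)
    (hF : PublishedFactsTwoPlus) :
    Summit.BirchSwinnertonDyer.BirchSwinnertonDyer.Theses.SylvesterTwoHeegnerIndex.HSYPointTwoDivisibleSevenModNine :=
  thmC_of_printStubs hPI hF

/-! ## §2 The crux `UpperOffV0HSYPlus` (item 19804) from the prints -/

set_option maxHeartbeats 1600000 in
/-- **THEOREM K3 typed (`CoupledUpperBoundAtTwoFourModNine`) from the prints**, granted `PublishedFactsTwoPlus`: first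
layer (`firstLayerFour_of_layerL1 ∘ layerL1Four_of_named_of_flip`) + tail (`tailFour_of_residue (vii) H3_holds LP_holds
residueFour_of_printInputs`) — the skeleton's `firstLayerFour_closed` / `tailFour_closed` composition.  CONDITIONAL; BSD is
proved for no curve. [cite: HuShuYin2019, Thm. 1.4, Cor. 4.4, display (bsd) p. 12] [cite: McCallumLMS1991, §4–§5, Thm. 5.4]
[cite: Nekovar2007, Prop. 4.9] [cite: MilneADT2006, Ch. I §6 Prop. 6.9, Thm. 6.13 (a)] -/
theorem coupledUpperBoundFour_of_prints (hF : PublishedFactsTwoPlus)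
    (Dt : ModularParametrizationData (⟨0, 0, 1, 0, -1⟩ : WeierstrassCurve ℚ) 243) (hdeg : Dt.deg = 6)
    (hD : shaAnPair_mul_height_eq_two_zpow_mul_height_named) (hES2 : Nekovar2007.cmPoint_frobeniusCongruence)
    (hVII : ∀ (K : Type) [Field K] [NumberField K] (σ₀ : K ≃ₐ[ℚ] K) (h2 : Module.finrank ℚ K = 2) (hσ₀ : σ₀ ≠ 1),
      casselsTate_canonical_adjoint K σ₀ h2 hσ₀) :
    CoupledUpperBoundAtTwoFourModNine :=
  coupledUpperBoundFour_of_firstLayer_of_tail hF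
    (firstLayerFour_of_layerL1 (SylvesterTwoCMFlip.layerL1Four_of_named_of_flip Dt hdeg hD hES2) hF)
    (tailFour_of_residue (fun K _ _ σ₀ h2 hσ₀ ↦ (hVII K σ₀ h2 hσ₀).2) H3_holds LP_holds
      (residueFour_of_printInputs Dt hdeg hD hES2) hF)

set_option maxHeartbeats 1600000 in
/-- **THEOREM K3\* typed (`CoupledUpperBoundAtTwoSevenModNine`) from the prints and a `⟨w₂₄₃, A⟩`-invariant `Dt`**, granted
`PublishedFactsTwoPlus`: THEOREM C (§1) + first layer (`firstLayerSeven_of_layerL1 ∘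
layerL1Seven_of_named_of_flip_of_levelInvolutionFixing`) + tail (`tailSeven_of_residue_halved (vii) H3_holds LP_holds
residueSevenHalved_of_printInputs`) — the skeleton's `firstLayerSeven_closed` / `tailSeven_closed` composition with
`stub_levelFixingSeven` := g33's `levelFixingSeven_of_isS3Invariant`.  CONDITIONAL; BSD is proved for no curve.
[cite: HuShuYin2019, Thm. 1.4, Prop. 2.1 (1), Cor. 4.4, display (bsd) p. 12, §4.1] [cite: McCallumLMS1991, §4–§5, Thm. 5.4]
[cite: GrossLMS1991, §3–§6] [cite: Nekovar2007, Prop. 4.9] [cite: MilneADT2006, Ch. I §6 Prop. 6.9, Thm. 6.13 (a)] -/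
theorem coupledUpperBoundSeven_of_isS3Invariant (hF : PublishedFactsTwoPlus)
    (Dt : ModularParametrizationData (⟨0, 0, 1, 0, -1⟩ : WeierstrassCurve ℚ) 243) (hdeg : Dt.deg = 6)
    (hD : shaAnPair_mul_height_eq_two_zpow_mul_height_named) (hES2 : Nekovar2007.cmPoint_frobeniusCongruence)
    (hS3 : IsS3Invariant Dt)
    (hVII : ∀ (K : Type) [Field K] [NumberField K] (σ₀ : K ≃ₐ[ℚ] K) (h2 : Module.finrank ℚ K = 2) (hσ₀ : σ₀ ≠ 1),
      casselsTate_canonical_adjoint K σ₀ h2 hσ₀) :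
    CoupledUpperBoundAtTwoSevenModNine :=
  coupledUpperBoundSeven_of_thmC_of_firstLayer_of_tail hF
    (firstLayerSeven_of_layerL1
      (SylvesterTwoCMHalf.layerL1Seven_of_named_of_flip_of_levelInvolutionFixing Dt hdeg hD hES2
        (levelFixingSeven_of_isS3Invariant Dt hS3) (thmC_of_isS3Invariant Dt hdeg hD hS3 hF)) hF)
    (tailSeven_of_residue_halved (fun K _ _ σ₀ h2 hσ₀ ↦ (hVII K σ₀ h2 hσ₀).2) H3_holds LP_holds
      (fun hF' ↦ residueSevenHalved_of_printInputs Dt hdeg hD hES2 (thmC_of_isS3Invariant Dt hdeg hD hS3 hF')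
        (levelFixingSeven_of_isS3Invariant Dt hS3) hF') hF)
    (thmC_of_isS3Invariant Dt hdeg hD hS3 hF)

set_option maxHeartbeats 1600000 in
/-- ★★ **The crux `UpperOffV0HSYPlus` (item 19804) BY NAME from a `⟨w₂₄₃, A⟩`-invariant degree-6 `Dt`, #19, #20 and VII**
(VARIANT R′'s `UpperOffV0HSYPlus_of` with the three stubs as hypotheses and `stub_levelFixingSeven` := g33's theorem):
`upperOffV0HSYPlus_of_coupledUpperBounds` on THEOREMS K3 / K3\* typed.  CONDITIONAL; item 19804 is not closed by this;
X12.CMAtTwo NOT proved; BSD is proved for no curve.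
[cite: HuShuYin2019, Thm. 1.4, Prop. 2.1 (1), Cor. 4.4, display (bsd) p. 12, §4.1] [cite: McCallumLMS1991, §4–§5, Thm. 5.4]
[cite: GrossLMS1991, §3–§6] [cite: Nekovar2007, Prop. 4.9] [cite: MilneADT2006, Ch. I §6 Prop. 6.9, Thm. 6.13 (a)] -/
theorem upperOffV0HSYPlus_of_isS3Invariant
    (Dt : ModularParametrizationData (⟨0, 0, 1, 0, -1⟩ : WeierstrassCurve ℚ) 243) (hdeg : Dt.deg = 6)
    (hD : shaAnPair_mul_height_eq_two_zpow_mul_height_named) (hES2 : Nekovar2007.cmPoint_frobeniusCongruence)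
    (hS3 : IsS3Invariant Dt)
    (hVII : ∀ (K : Type) [Field K] [NumberField K] (σ₀ : K ≃ₐ[ℚ] K) (h2 : Module.finrank ℚ K = 2) (hσ₀ : σ₀ ≠ 1),
      casselsTate_canonical_adjoint K σ₀ h2 hσ₀) :
    Summit.BirchSwinnertonDyer.BirchSwinnertonDyer.Theses.SylvesterTwoHeegnerIndex.UpperOffV0HSYPlus :=
  fun hF ↦
    upperOffV0HSYPlus_of_coupledUpperBounds (coupledUpperBoundFour_of_prints hF Dt hdeg hD hES2 hVII)
      (coupledUpperBoundSeven_of_isS3Invariant hF Dt hdeg hD hES2 hS3 hVII) hF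

/-- ★★ **The crux `UpperOffV0HSYPlus` (item 19804) BY NAME from EXACTLY the types of VARIANT S's two PURE-CITE stubs**
(`stub_printInputsTwo` with the fourth conjunct (G3) `phi_s3Invariant_of_deg_eq_six`, planner D834 (3); `stub_printInputVII`),
nothing else.  READING OF RECORD: crux 19804 ⟸ PRINT {deg-6 `Dt`, #19 named, #20 (ES2), (G3), VII} granted its own antecedent
`PublishedFactsTwoPlus`; zero research hypotheses.  CONDITIONAL ((G3) admitted, planner D816/D819); item 19804 is not closed
by this; X12.CMAtTwo NOT proved; BSD is proved for no curve.
[cite: HuShuYin2019, Thm. 1.4, Prop. 2.1 (1), Cor. 4.4, display (bsd) p. 12, §4.1] [cite: McCallumLMS1991, §4–§5, Thm. 5.4]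
[cite: GrossLMS1991, §3–§6] [cite: Nekovar2007, Prop. 4.9] [cite: MilneADT2006, Ch. I §6 Prop. 6.9, Thm. 6.13 (a)] -/
theorem upperOffV0HSYPlus_of_printStubs
    (hPI : (∃ Dt : ModularParametrizationData (⟨0, 0, 1, 0, -1⟩ : WeierstrassCurve ℚ) 243, Dt.deg = 6) ∧
      shaAnPair_mul_height_eq_two_zpow_mul_height_named ∧ Nekovar2007.cmPoint_frobeniusCongruence ∧
      phi_s3Invariant_of_deg_eq_six)
    (hVII : ∀ (K : Type) [Field K] [NumberField K] (σ₀ : K ≃ₐ[ℚ] K) (h2 : Module.finrank ℚ K = 2) (hσ₀ : σ₀ ≠ 1),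
      casselsTate_canonical_adjoint K σ₀ h2 hσ₀) :
    Summit.BirchSwinnertonDyer.BirchSwinnertonDyer.Theses.SylvesterTwoHeegnerIndex.UpperOffV0HSYPlus := by
  obtain ⟨⟨Dt, hdeg⟩, hD, hES2, hG3⟩ := hPI
  exact upperOffV0HSYPlus_of_isS3Invariant Dt hdeg hD hES2 (hG3 Dt hdeg) hVII

/-! ## §3 The UPPER item 19725, the hand item 19229 and the rung leaf from the prints -/

/-- ★★ **The UPPER crux `HeegnerIndexUpperAtTwoHSYOfFactsPlus` (item 19725) BY NAME from the two print stub types**: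
the closed glue 19805 (`heegnerIndexUpperOfPartsPlusHSY_proof`, p431798's `upperOfFacts_of_twoAdicPair_of_offV0`) on
THEOREM C (§1, at the facts-plus antecedent), the closed child 19803 (`twoAdicPairHSYOfFactsPlusOfThmC_proof`) and ★★
`upperOffV0HSYPlus_of_printStubs`.  CONDITIONAL; item 19725 is not closed by this; BSD is proved for no curve.
[cite: HuShuYin2019, Thm. 1.4, Prop. 2.1 (1), Cor. 4.4, display (bsd) p. 12, §4.1] [cite: McCallumLMS1991, §4–§5, Thm. 5.4]
[cite: GrossZagier1986, V §2] [cite: Nekovar2007, Prop. 4.9] [cite: MilneADT2006, Ch. I §6 Prop. 6.9, Thm. 6.13 (a)] -/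
theorem heegnerIndexUpperAtTwoHSYOfFactsPlus_of_printStubs
    (hPI : (∃ Dt : ModularParametrizationData (⟨0, 0, 1, 0, -1⟩ : WeierstrassCurve ℚ) 243, Dt.deg = 6) ∧
      shaAnPair_mul_height_eq_two_zpow_mul_height_named ∧ Nekovar2007.cmPoint_frobeniusCongruence ∧
      phi_s3Invariant_of_deg_eq_six)
    (hVII : ∀ (K : Type) [Field K] [NumberField K] (σ₀ : K ≃ₐ[ℚ] K) (h2 : Module.finrank ℚ K = 2) (hσ₀ : σ₀ ≠ 1),
      casselsTate_canonical_adjoint K σ₀ h2 hσ₀) :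
    Summit.BirchSwinnertonDyer.BirchSwinnertonDyer.Theses.SylvesterTwoHeegnerIndex.HeegnerIndexUpperAtTwoHSYOfFactsPlus :=
  fun hFP ↦
    heegnerIndexUpperOfPartsPlusHSY_proof (hsyPointTwoDivisibleSevenModNine_of_printStubs hPI hFP)
      twoAdicPairHSYOfFactsPlusOfThmC_proof (upperOffV0HSYPlus_of_printStubs hPI hVII) hFP

/-- ★★★ **THE HAND ITEM 19229 `HeegnerIndexUpperAtTwoHSY` BY NAME ⟸ `PublishedFactsTwoPlus` + the two print stub types** —
the Kolyvagin direction `ord₂ #Ш(E_p) ≤ ord₂ 𝔮` in every Heegner frame on 𝒞_HSY, granted the route's published facts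
(`PublishedFactsTwoPlus`, items 19231/19724) and the displayed PRINT inputs {deg-6 `Dt`, #19 named, #20 (ES2), (G3), VII}:
`SylvesterTwoResidualsSharp.heegnerIndexUpperAtTwoHSY_of_facts_of_coupledUpperBounds` on THEOREMS K3 / K3\* typed (§2).
READING OF RECORD for the hand «find: 19229»: FOUND AS A CONDITIONAL THEOREM with print-only hypotheses — no research
statement, no cell lemma, no certificate enters.  CONDITIONAL ((G3) admitted; the facts are named Literature `Prop`s);
item 19229 (aside) is not closed by this (its fact-free statement is meaningful only behind the facts, planner D82 (a));
X12.CMAtTwo NOT proved; BSD is proved for no curve.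
[cite: HuShuYin2019, Thm. 1.4, Prop. 2.1 (1), Cor. 4.4, display (bsd) p. 12, §4.1] [cite: Kolyvagin1990, Thm. A]
[cite: McCallumLMS1991, §4–§5, Thm. 5.4] [cite: GrossLMS1991, §3–§6] [cite: Nekovar2007, Prop. 4.9]
[cite: MilneADT2006, Ch. I §6 Prop. 6.9, Thm. 6.13 (a)] -/
theorem heegnerIndexUpperAtTwoHSY_of_publishedFactsTwoPlus_of_printStubs (hF : PublishedFactsTwoPlus)
    (hPI : (∃ Dt : ModularParametrizationData (⟨0, 0, 1, 0, -1⟩ : WeierstrassCurve ℚ) 243, Dt.deg = 6) ∧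
      shaAnPair_mul_height_eq_two_zpow_mul_height_named ∧ Nekovar2007.cmPoint_frobeniusCongruence ∧
      phi_s3Invariant_of_deg_eq_six)
    (hVII : ∀ (K : Type) [Field K] [NumberField K] (σ₀ : K ≃ₐ[ℚ] K) (h2 : Module.finrank ℚ K = 2) (hσ₀ : σ₀ ≠ 1),
      casselsTate_canonical_adjoint K σ₀ h2 hσ₀) :
    Summit.BirchSwinnertonDyer.BirchSwinnertonDyer.Theses.SylvesterTwoHeegnerIndex.HeegnerIndexUpperAtTwoHSY := by
  obtain ⟨⟨Dt, hdeg⟩, hD, hES2, hG3⟩ := hPI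
  exact SylvesterTwoResidualsSharp.heegnerIndexUpperAtTwoHSY_of_facts_of_coupledUpperBounds hF.1
    (coupledUpperBoundFour_of_prints hF Dt hdeg hD hES2 hVII)
    (coupledUpperBoundSeven_of_isS3Invariant hF Dt hdeg hD hES2 (hG3 Dt hdeg) hVII)

/-- ★★★ **The rung leaf `X12.CMAtTwo` (BSD(E_p, 2) on 𝒞_HSY) ⟸ the LOWER half + `PublishedFactsTwoPlus` + the two print stub
types**, through the kernel bridge of the closed Assembly 19232 (`CMRungInputs.cmAtTwo_of_inputs`, p406906: LOWER → UPPER →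
`PublishedFactsTwo` → `X12.CMAtTwo`) with UPPER := ★★★ above.  What the K7t rung still needs after (W2-b), read off the binders: the OPEN crux
`HeegnerIndexLowerAtTwoHSY` (the Gross–Zagier / main-conjecture direction at `2`, items 19477/19891/19892), the published
facts, and the displayed print inputs.  CONDITIONAL; nothing is asserted about the LOWER half; X12.CMAtTwo is NOT proved;
BSD is proved for no curve, by none of this.
[cite: GrossZagier1986, V §2] [cite: HuShuYin2019, Thm. 1.4, Prop. 2.1 (1), Cor. 4.4, display (bsd) p. 12, §4.1]
[cite: Kolyvagin1990, Thm. A] [cite: McCallumLMS1991, §4–§5, Thm. 5.4] [cite: Nekovar2007, Prop. 4.9]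
[cite: MilneADT2006, Ch. I §6 Prop. 6.9, Thm. 6.13 (a)] -/
theorem cmAtTwo_of_lower_of_publishedFactsTwoPlus_of_printStubs
    (hlo : Summit.BirchSwinnertonDyer.BirchSwinnertonDyer.Theses.SylvesterTwoHeegnerIndex.HeegnerIndexLowerAtTwoHSY)
    (hF : PublishedFactsTwoPlus)
    (hPI : (∃ Dt : ModularParametrizationData (⟨0, 0, 1, 0, -1⟩ : WeierstrassCurve ℚ) 243, Dt.deg = 6) ∧
      shaAnPair_mul_height_eq_two_zpow_mul_height_named ∧ Nekovar2007.cmPoint_frobeniusCongruence ∧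
      phi_s3Invariant_of_deg_eq_six)
    (hVII : ∀ (K : Type) [Field K] [NumberField K] (σ₀ : K ≃ₐ[ℚ] K) (h2 : Module.finrank ℚ K = 2) (hσ₀ : σ₀ ≠ 1),
      casselsTate_canonical_adjoint K σ₀ h2 hσ₀) :
    Summit.BirchSwinnertonDyer.Rank1Residual.X12.CMAtTwo :=
  Summit.BirchSwinnertonDyer.BirchSwinnertonDyer.Rank1Residual.CMRungInputs.cmAtTwo_of_inputs hlo
    (heegnerIndexUpperAtTwoHSY_of_publishedFactsTwoPlus_of_printStubs hF hPI hVII) hF.1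

end Summit.BirchSwinnertonDyer.BirchSwinnertonDyer.Theorems.SylvesterTwoUpperCone

end
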